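import Summits.Schanuel.Schanuel.Theorems.RootDecomp1ConjugateSieveCore

/-!
# RootDecomp1ConjugateSieve («CONJUGATE SIEVE», lens 1 gen 17) — continuation (RootDecomp1ConjugateSieve): §3 item D (binders verbatim) on the σ-balanced arg-rich power planes UNCONDITIONALLY (disjointSaturatedEssentialSchanuel_powerPlane_sigma) + §4 members by Lindemann–Weierstrass alone: z_e = (e^{i}, e^{1+i}, e^{2+i}) (member_zE, schanuel_at_zE_iff — S there OPEN), z_u = (e^{1−i}, e^{1+i}, e^{1+3i}) (member_zU)

Part of the two-file split (400-line rule) of lens 1's gen-17 node «CONJUGATE SIEVE» = HOME/decomp-schanuel-lens-1/g17/RootDecomp1ConjugateSieve.lean (sha256 06b528a3…, 694 l;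
ROUND 17 of route-Schanuel-RootDecomp1, THEOREM ROUND under STANDING (xi) trigger (β); critic VERDICT 2026-08-30T18:43:40Z ACCEPTED — one decision credit: Cell(2,0) decided BY THEOREM at the
explicit tuples z_e, z_u; `--supports stmt-Schanuel-30353`). Port hygiene: §0 twins are the landed ones (RootDecomp1ResidueSieveFourExp.powerPlane …, AdditiveCells/AdditiveCellsD/ValueCells) opened
by name; small foreign twins private. Shared namespace `Summit.Schanuel.Schanuel.Theorems.RootDecomp1ConjugateSieve`; the node docstring is in the Core part. Sorry-free; standard axioms.
WORDING (critic): D decided at z_e / z_u BY THEOREM (LW only); Schanuel there OPEN; σ-rigid planes (z_F-type) stay conditional on FourExponentialsConjecture (round 16). Nothing here proves Schanuel; rung 0.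
-/

noncomputable section

namespace Summit.Schanuel.Schanuel.Theorems.RootDecomp1ConjugateSieve

open Complex IntermediateField Module Polynomial
open scoped ComplexConjugate
open Literature.NumberTheory.Transcendental (exists_nsmul_mem_span_int six_exponentials_holds
  transcendental_exp_holds algebraicIndependent_exp_holds linearIndependent_exp_holds FourExponentialsConjecture)
open Summit.Schanuel.Schanuel.Theorems.RootDecomp1EAnchor (isAlgebraic_of_mem_adjoin trdeg_adjoin_le_of_isAlgebraic
  trdeg_adjoin_le_nat)
open Summit.Schanuel.Schanuel.Theorems.RootDecomp1EEStableRung (one_le_trdeg_adjoin_of_transcendental)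
open Summit.Schanuel.Schanuel.Theorems.RootDecomp1ArgumentCells (le_trdeg_of_algebraicIndependent_mem)
open Summit.Schanuel.Schanuel.Theorems.RootDecomp1ResidueSieve (powerPlane powerPlane_zero powerPlane_one powerPlane_two
  two_le_argDegree_powerPlane)
open Summit.Schanuel.Schanuel.Theorems.RootDecomp1AdditiveCells (le_trdeg_of_additive_cert)
open Summit.Schanuel.Schanuel.Theorems.RootDecomp1AdditiveCellsD (pair_one_linearIndependent)
open Summit.Schanuel.Schanuel.Theorems.RootDecomp1ValueCells (exp_mem_vals_of_mem_span_int)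

/-! ## §3  ITEM D ON THE σ-BALANCED ARG-RICH POWER PLANES — unconditional -/

/-- **D on family F_R (pointwise, hypothesis-free):** `y₀, ρ` algebraically independent, `conj ρ = ±ρ`,
`(y₀, y₀ρ, conj y₀)` ℚ-free, `ε = 0` ⟹ `3 ≤ trdeg ℚ(z, e^z)` for `z = y₀(1, ρ, ρ²)`:
`a = 2` (round 16) `+ v ≥ 1` (conjugate sieve) `= 3`. -/
theorem disjointSchanuel_powerPlane_of_conj {y₀ ρ : ℂ} (hai : AlgebraicIndependent ℚ ![y₀, ρ])
    (hρ : conj ρ = ρ ∨ conj ρ = -ρ) (hy : LinearIndependent ℚ ![y₀, y₀ * ρ, conj y₀])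
    (hsplit : Algebra.trdeg ℚ ↥(adjoin ℚ (Set.range (powerPlane y₀ ρ))) +
        Algebra.trdeg ℚ ↥(adjoin ℚ (Set.range (cexp ∘ powerPlane y₀ ρ))) ≤
      Algebra.trdeg ℚ ↥(adjoin ℚ (Set.range (powerPlane y₀ ρ) ∪ Set.range (cexp ∘ powerPlane y₀ ρ)))) :
    ((3 : ℕ) : Cardinal) ≤
      Algebra.trdeg ℚ ↥(adjoin ℚ (Set.range (powerPlane y₀ ρ) ∪ Set.range (cexp ∘ powerPlane y₀ ρ))) := by
  have hρt : Transcendental ℚ ρ := by simpa using hai.transcendental 1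
  have hv := one_le_valDegree_of_exists (powerPlane y₀ ρ)
    (exists_transcendental_exp_powerPlane_of_conj hρ (pair_one_linearIndependent hρt) hy)
  exact le_trdeg_of_additive_cert _ (a := 2) (v := 1) (by exact_mod_cast two_le_argDegree_powerPlane hai)
    (by exact_mod_cast hv) hsplit (by norm_num)

/-- **D on family F_U (pointwise, hypothesis-free):** `y₀, conj y₀ / y₀` algebraically independent,
`(y₀, conj y₀)` and `(1, conj y₀/y₀, y₀/conj y₀)` ℚ-free, `ε = 0` ⟹ `3 ≤ trdeg ℚ(z, e^z)`. -/
theorem disjointSchanuel_powerPlane_unimodular {y₀ : ℂ} (hai : AlgebraicIndependent ℚ ![y₀, conj y₀ / y₀])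
    (hX : LinearIndependent ℚ ![y₀, conj y₀]) (hY : LinearIndependent ℚ ![(1 : ℂ), conj y₀ / y₀, y₀ / conj y₀])
    (hsplit : Algebra.trdeg ℚ ↥(adjoin ℚ (Set.range (powerPlane y₀ (conj y₀ / y₀)))) +
        Algebra.trdeg ℚ ↥(adjoin ℚ (Set.range (cexp ∘ powerPlane y₀ (conj y₀ / y₀)))) ≤
      Algebra.trdeg ℚ ↥(adjoin ℚ (Set.range (powerPlane y₀ (conj y₀ / y₀)) ∪
        Set.range (cexp ∘ powerPlane y₀ (conj y₀ / y₀))))) :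
    ((3 : ℕ) : Cardinal) ≤ Algebra.trdeg ℚ ↥(adjoin ℚ (Set.range (powerPlane y₀ (conj y₀ / y₀)) ∪
        Set.range (cexp ∘ powerPlane y₀ (conj y₀ / y₀)))) :=
  le_trdeg_of_additive_cert _ (a := 2) (v := 1) (by exact_mod_cast two_le_argDegree_powerPlane hai)
    (by exact_mod_cast one_le_valDegree_of_exists _ (exists_transcendental_exp_powerPlane_unimodular hX hY))
    hsplit (by norm_num)

/-- **THE σ-CELL OF ITEM D (item form, binders of stmt-Schanuel-30353 verbatim, NO named hypothesis):** on the cell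
`{n = 3, z an arg-rich power plane y₀(1,ρ,ρ²) of family F_R or F_U}` item D HOLDS.  Compare round 16's
`disjointSaturatedEssentialSchanuel_powerPlane_of_fourExp (hF : FourExponentialsConjecture)`: the conjugate sieve
removes the FEC hypothesis on the σ-balanced sub-cell. -/
theorem disjointSaturatedEssentialSchanuel_powerPlane_sigma :
    ∀ (n : ℕ), 3 ≤ n → ∀ (z : Fin n → ℂ), LinearIndependent ℚ z →
      (n ≤ 3 ∧ ∃ y₀ ρ : ℂ, AlgebraicIndependent ℚ ![y₀, ρ] ∧ Set.range z = Set.range (powerPlane y₀ ρ) ∧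
        (((conj ρ = ρ ∨ conj ρ = -ρ) ∧ LinearIndependent ℚ ![y₀, y₀ * ρ, conj y₀]) ∨
         (ρ = conj y₀ / y₀ ∧ LinearIndependent ℚ ![y₀, conj y₀] ∧
           LinearIndependent ℚ ![(1 : ℂ), conj y₀ / y₀, y₀ / conj y₀]))) →
      (∀ i, z i ∈ Literature.NumberTheory.Transcendental.ecl (∅ : Set ℂ)) →
      (∀ (m : ℕ), m < n → ∀ (w : Fin m → ℂ), LinearIndependent ℚ w →
        (∀ i, w i ∈ Submodule.span ℚ (Set.range z)) →
        (m : Cardinal) ≤ Algebra.trdeg ℚ ↥(IntermediateField.adjoin ℚ (Set.range w ∪ Set.range (Complex.exp ∘ w)))) →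
      (∀ w : ℂ, IsAlgebraic ↥(IntermediateField.adjoin ℚ (Set.range z ∪ Set.range (Complex.exp ∘ z))) w →
        IsAlgebraic ↥(IntermediateField.adjoin ℚ (Set.range z ∪ Set.range (Complex.exp ∘ z))) (Complex.exp w) →
        w ∈ Submodule.span ℚ (Set.range z)) →
      (∀ (k : ℕ) (t : Fin k → ℂ) (β₀ γ₀ : Fin n → ℂ) (β γ : Fin n → Fin k → ℂ), (∀ i, IsAlgebraic ℚ (β₀ i)) →
        (∀ i j, IsAlgebraic ℚ (β i j)) → (∀ i, IsAlgebraic ℚ (γ₀ i)) → (∀ i j, IsAlgebraic ℚ (γ i j)) →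
        (∀ i, z i = β₀ i + ∑ j, β i j * t j) → (∀ i, Complex.exp (z i) = γ₀ i + ∑ j, γ i j * t j) → n ≤ k) →
      (∀ (k : ℕ) (t : Fin k → ℂ) (β₀ γ₀ : Fin n → ℂ) (β γ : Fin n → Fin k → ℂ) (δ ε : Fin n → Fin k → Fin k → ℂ),
        (∀ i, IsAlgebraic ℚ (β₀ i)) → (∀ i j, IsAlgebraic ℚ (β i j)) → (∀ i j j', IsAlgebraic ℚ (δ i j j')) →
        (∀ i, IsAlgebraic ℚ (γ₀ i)) → (∀ i j, IsAlgebraic ℚ (γ i j)) → (∀ i j j', IsAlgebraic ℚ (ε i j j')) →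
        (∀ i, z i = β₀ i + ∑ j, β i j * t j + ∑ j, ∑ j', δ i j j' * (t j * t j')) →
        (∀ i, Complex.exp (z i) = γ₀ i + ∑ j, γ i j * t j + ∑ j, ∑ j', ε i j j' * (t j * t j')) → n ≤ k) →
      (∀ (k : ℕ) (t : Fin k → ℂ) (D : MvPolynomial (Fin k) ℂ) (N E : Fin n → MvPolynomial (Fin k) ℂ),
        (∀ m, IsAlgebraic ℚ (MvPolynomial.coeff m D)) → (∀ i m, IsAlgebraic ℚ (MvPolynomial.coeff m (N i))) →
        (∀ i m, IsAlgebraic ℚ (MvPolynomial.coeff m (E i))) → MvPolynomial.eval t D ≠ 0 →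
        (∀ i, z i * MvPolynomial.eval t D = MvPolynomial.eval t (N i)) →
        (∀ i, Complex.exp (z i) * MvPolynomial.eval t D = MvPolynomial.eval t (E i)) → n ≤ k) →
      (Algebra.trdeg ℚ ↥(IntermediateField.adjoin ℚ (Set.range z)) +
          Algebra.trdeg ℚ ↥(IntermediateField.adjoin ℚ (Set.range (Complex.exp ∘ z))) ≤
        Algebra.trdeg ℚ ↥(IntermediateField.adjoin ℚ (Set.range z ∪ Set.range (Complex.exp ∘ z)))) →
      (n : Cardinal) ≤ Algebra.trdeg ℚ ↥(IntermediateField.adjoin ℚ (Set.range z ∪ Set.range (Complex.exp ∘ z))) := by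
  intro n hn z hz hcell _ _ _ _ _ _ hsplit
  obtain rfl : n = 3 := le_antisymm hcell.1 hn
  obtain ⟨y₀, ρ, hai, hzr, hfam⟩ := hcell.2
  have e1 : Set.range (Complex.exp ∘ z) = Set.range (cexp ∘ powerPlane y₀ ρ) := by
    rw [Set.range_comp, Set.range_comp, hzr]
  rw [e1, hzr] at hsplit ⊢
  rcases hfam with ⟨hρ, hy⟩ | ⟨rfl, hX, hY⟩
  · exact disjointSchanuel_powerPlane_of_conj hai hρ hy hsplit
  · exact disjointSchanuel_powerPlane_unimodular hai hX hY hsplit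

/-! ## §4  MEMBERS, certified by Lindemann–Weierstrass alone

### small algebraic toolkit for the certifications -/

/-- `I` is algebraic (`I² + 1 = 0`). -/
private theorem isAlgebraic_I : IsAlgebraic ℚ I := by
  refine ⟨Polynomial.X ^ 2 + 1, Polynomial.Monic.ne_zero (by monicity!), ?_⟩
  simp

/-- `IsAlgebraic ℚ (2 : ℂ)`. -/
private theorem isAlgebraic_two : IsAlgebraic ℚ (2 : ℂ) := by
  have h : IsAlgebraic ℚ ((2 : ℚ) : ℂ) := isAlgebraic_algebraMap (2 : ℚ)
  simpa using h

/-- `IsAlgebraic ℚ (3 : ℂ)`. -/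
private theorem isAlgebraic_three : IsAlgebraic ℚ (3 : ℂ) := by
  have h : IsAlgebraic ℚ ((3 : ℚ) : ℂ) := isAlgebraic_algebraMap (3 : ℚ)
  simpa using h

/-- A pair `(a, b)` with `Re a · Im b ≠ Im a · Re b` is even `ℝ`-free, hence ℚ-free. -/
theorem linearIndependent_pair_of_det {a b : ℂ} (h : a.re * b.im ≠ a.im * b.re) :
    LinearIndependent ℚ ![a, b] := by
  rw [LinearIndependent.pair_iff]
  intro s t hst
  have e : (s : ℂ) * a + (t : ℂ) * b = 0 := by simpa [Rat.smul_def] using hst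
  have hre := congrArg Complex.re e
  have him := congrArg Complex.im e
  simp only [Complex.add_re, Complex.mul_re, Complex.ratCast_re, Complex.ratCast_im, zero_mul, sub_zero,
    Complex.zero_re, Complex.add_im, Complex.mul_im, add_zero, Complex.zero_im] at hre him
  have hs : (s : ℝ) * (a.re * b.im - a.im * b.re) = 0 := by linear_combination b.im * hre - b.re * him
  have ht : (t : ℝ) * (a.re * b.im - a.im * b.re) = 0 := by linear_combination a.re * him - a.im * hre
  have hne : a.re * b.im - a.im * b.re ≠ 0 := sub_ne_zero.mpr h
  have hs' := (mul_eq_zero.mp hs).resolve_right hne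
  have ht' := (mul_eq_zero.mp ht).resolve_right hne
  exact ⟨by exact_mod_cast hs', by exact_mod_cast ht'⟩

/-- Three pairwise distinct numbers form an injective triple. -/
theorem injective_triple {a b c : ℂ} (hab : a ≠ b) (hac : a ≠ c) (hbc : b ≠ c) :
    Function.Injective ![a, b, c] := by
  intro i j hij
  fin_cases i <;> fin_cases j
  · rfl
  · exact absurd (by simpa using hij : a = b) hab
  · exact absurd (by simpa using hij : a = c) hac
  · exact absurd (Eq.symm (by simpa using hij : b = a)) hab
  · rfl
  · exact absurd (by simpa using hij : b = c) hbc
  · exact absurd (Eq.symm (by simpa using hij : c = a)) hac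
  · exact absurd (Eq.symm (by simpa using hij : c = b)) hbc
  · rfl

/-- Lindemann–Weierstrass, Baker's form, for a triple of pairwise distinct algebraic exponents, over `ℚ`. -/
theorem linearIndependent_exp_triple {a b c : ℂ} (ha : IsAlgebraic ℚ a) (hb : IsAlgebraic ℚ b)
    (hc : IsAlgebraic ℚ c) (hab : a ≠ b) (hac : a ≠ c) (hbc : b ≠ c) :
    LinearIndependent ℚ ![cexp a, cexp b, cexp c] := by
  have h := linearIndependent_exp_holds ![a, b, c]
    (fun i => by
      fin_cases i
      · simpa using ha
      · simpa using hb
      · simpa using hc) (injective_triple hab hac hbc)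
  have h' : LinearIndependent ℚ fun i => cexp (![a, b, c] i) := linearIndependent_rat_of_algClosure h
  convert h' using 1
  funext i
  fin_cases i <;> simp

/-- Lindemann–Weierstrass, Weierstrass' form, for a ℚ-free pair of algebraic exponents. -/
theorem algebraicIndependent_exp_pair {a b : ℂ} (ha : IsAlgebraic ℚ a) (hb : IsAlgebraic ℚ b)
    (hab : LinearIndependent ℚ ![a, b]) : AlgebraicIndependent ℚ ![cexp a, cexp b] := by
  have h := algebraicIndependent_exp_holds ![a, b]
    (fun i => by
      fin_cases i
      · simpa using ha
      · simpa using hb) hab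
  convert h using 1
  funext i
  fin_cases i <;> simp

/-! ### `z_e = e^{i}·(1, e, e²) = (e^{i}, e^{1+i}, e^{2+i})` (family F_R: `ρ = e` real, `y₀ = e^{i}` oblique) -/

/-- The member `z_e`. -/
def zE : Fin 3 → ℂ := powerPlane (cexp I) (cexp 1)

/-- `zE = ![cexp I, cexp (1 + I), cexp (2 + I)]`. -/
theorem zE_eq : zE = ![cexp I, cexp (1 + I), cexp (2 + I)] := by
  funext k
  fin_cases k
  · simp [zE]
  · simp [zE, ← Complex.exp_add, add_comm]
  · simp only [zE, powerPlane_two, Fin.reduceFinMk, Matrix.cons_val]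
    rw [sq, ← Complex.exp_add, ← Complex.exp_add]
    ring_nf

/-- `e^{i}` and `e` are algebraically independent (Lindemann–Weierstrass: `i, 1` are ℚ-free algebraic numbers). -/
theorem algebraicIndependent_expI_exp1 : AlgebraicIndependent ℚ ![cexp I, cexp 1] :=
  algebraicIndependent_exp_pair isAlgebraic_I isAlgebraic_one (linearIndependent_pair_of_det (by norm_num))

/-- `conj e = e`. -/
theorem conj_exp_one : conj (cexp 1) = cexp 1 := by
  rw [← Complex.exp_conj, map_one]

/-- `(e^{i}, e^{i}·e, conj e^{i}) = (e^{i}, e^{1+i}, e^{-i})` is ℚ-free (distinct algebraic exponents). -/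
theorem linearIndependent_zE_triple : LinearIndependent ℚ ![cexp I, cexp I * cexp 1, conj (cexp I)] := by
  have h := linearIndependent_exp_triple (a := I) (b := I + 1) (c := -I) isAlgebraic_I
    (isAlgebraic_I.add isAlgebraic_one) isAlgebraic_I.neg
    (fun e => by have := congrArg Complex.re e; norm_num at this)
    (fun e => by have := congrArg Complex.im e; norm_num at this)
    (fun e => by have := congrArg Complex.re e; norm_num at this)
  convert h using 1
  funext i
  fin_cases i
  · simp
  · simp [Complex.exp_add]
  · simp [← Complex.exp_conj]

/-- **Member `z_e` (D decided — holds — by theorem; nothing open is used):** `ε = 0 ⟹ 3 ≤ trdeg ℚ(z_e, e^{z_e})`. -/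
theorem member_zE
    (hsplit : Algebra.trdeg ℚ ↥(adjoin ℚ (Set.range zE)) + Algebra.trdeg ℚ ↥(adjoin ℚ (Set.range (cexp ∘ zE))) ≤
      Algebra.trdeg ℚ ↥(adjoin ℚ (Set.range zE ∪ Set.range (cexp ∘ zE)))) :
    ((3 : ℕ) : Cardinal) ≤ Algebra.trdeg ℚ ↥(adjoin ℚ (Set.range zE ∪ Set.range (cexp ∘ zE))) :=
  disjointSchanuel_powerPlane_of_conj algebraicIndependent_expI_exp1 (Or.inl conj_exp_one)
    linearIndependent_zE_triple hsplit

/-- **By-product (unconditional, new in the tree): one of `exp(e^{i})`, `exp(e^{1+i})`, `exp(e^{2+i})` is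
transcendental.** -/
theorem exists_transcendental_exp_exp_I :
    Transcendental ℚ (cexp (cexp I)) ∨ Transcendental ℚ (cexp (cexp (1 + I))) ∨
      Transcendental ℚ (cexp (cexp (2 + I))) := by
  obtain ⟨k, hk⟩ := exists_transcendental_exp_powerPlane_of_conj (y₀ := cexp I) (ρ := cexp 1)
    (Or.inl conj_exp_one) (pair_one_linearIndependent (by simpa using algebraicIndependent_expI_exp1.transcendental 1))
    linearIndependent_zE_triple
  have hk' : Transcendental ℚ (cexp (zE k)) := hk
  rw [zE_eq] at hk'
  fin_cases k
  · exact Or.inl (by simpa using hk')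
  · exact Or.inr (Or.inl (by simpa using hk'))
  · exact Or.inr (Or.inr (by simpa using hk'))

/-- `z_e` is ℚ-free, so it is a genuine instance of the Schanuel format `n = 3`. -/
theorem zE_linearIndependent : LinearIndependent ℚ zE := by
  rw [zE_eq]
  exact linearIndependent_exp_triple isAlgebraic_I (isAlgebraic_one.add isAlgebraic_I)
    (isAlgebraic_two.add isAlgebraic_I)
    (fun e => by have := congrArg Complex.re e; norm_num at this)
    (fun e => by have := congrArg Complex.re e; norm_num at this)
    (fun e => by have := congrArg Complex.re e; norm_num at this)

/-- **Schanuel AT `z_e` — OPEN, displayed:** it is the statement `3 ≤ trdeg ℚ(e^{i}, e^{1+i}, e^{2+i}, exp e^{i},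
exp e^{1+i}, exp e^{2+i})`; the conjugate sieve decides D there (the `ε = 0` stratum), not this. -/
theorem schanuel_at_zE_iff :
    (((3 : ℕ) : Cardinal) ≤ Algebra.trdeg ℚ ↥(adjoin ℚ (Set.range zE ∪ Set.range (cexp ∘ zE)))) ↔
      ((3 : ℕ) : Cardinal) ≤ Algebra.trdeg ℚ ↥(adjoin ℚ
        ({cexp I, cexp (1 + I), cexp (2 + I), cexp (cexp I), cexp (cexp (1 + I)), cexp (cexp (2 + I))} : Set ℂ)) := by
  have e : Set.range zE ∪ Set.range (cexp ∘ zE) =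
      ({cexp I, cexp (1 + I), cexp (2 + I), cexp (cexp I), cexp (cexp (1 + I)), cexp (cexp (2 + I))} : Set ℂ) := by
    rw [zE_eq]
    ext w
    simp only [Set.mem_union, Set.mem_range, Function.comp_apply, Set.mem_insert_iff, Set.mem_singleton_iff]
    constructor
    · rintro (⟨k, rfl⟩ | ⟨k, rfl⟩) <;> fin_cases k <;> simp
    · rintro (rfl | rfl | rfl | rfl | rfl | rfl)
      · exact Or.inl ⟨0, by simp⟩
      · exact Or.inl ⟨1, by simp⟩
      · exact Or.inl ⟨2, by simp⟩
      · exact Or.inr ⟨0, by simp⟩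
      · exact Or.inr ⟨1, by simp⟩
      · exact Or.inr ⟨2, by simp⟩
  rw [e]

/-! ### `z_u = (e^{1-i}, e^{1+i}, e^{1+3i}) = e^{1-i}·(1, e^{2i}, e^{4i})` (family F_U) -/

/-- The member `z_u`. -/
def zU : Fin 3 → ℂ := powerPlane (cexp (1 - I)) (conj (cexp (1 - I)) / cexp (1 - I))

/-- `conj (cexp (1 - I)) = cexp (1 + I)`. -/
theorem conj_exp_one_sub_I : conj (cexp (1 - I)) = cexp (1 + I) := by
  rw [← Complex.exp_conj, map_sub, map_one, Complex.conj_I, sub_neg_eq_add]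

/-- `conj (cexp (1 - I)) / cexp (1 - I) = cexp (2 * I)`. -/
theorem rho_zU : conj (cexp (1 - I)) / cexp (1 - I) = cexp (2 * I) := by
  rw [conj_exp_one_sub_I, ← Complex.exp_sub]
  ring_nf

/-- `cexp (1 - I) / conj (cexp (1 - I)) = cexp (-(2 * I))`. -/
theorem rho_zU_inv : cexp (1 - I) / conj (cexp (1 - I)) = cexp (-(2 * I)) := by
  rw [conj_exp_one_sub_I, ← Complex.exp_sub]
  ring_nf

/-- `zU = ![cexp (1 - I), cexp (1 + I), cexp (1 + 3 * I)]`. -/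
theorem zU_eq : zU = ![cexp (1 - I), cexp (1 + I), cexp (1 + 3 * I)] := by
  funext k
  fin_cases k
  · simp [zU]
  · simp only [zU, powerPlane_one, Fin.mk_one, Matrix.cons_val_one, Matrix.cons_val_zero, rho_zU,
      ← Complex.exp_add]
    ring_nf
  · simp only [zU, powerPlane_two, Fin.reduceFinMk, Matrix.cons_val, rho_zU]
    rw [sq, ← Complex.exp_add, ← Complex.exp_add]
    ring_nf

/-- `e^{1-i}` and `e^{2i}` are algebraically independent (Lindemann–Weierstrass). -/
theorem algebraicIndependent_zU_pair :
    AlgebraicIndependent ℚ ![cexp (1 - I), conj (cexp (1 - I)) / cexp (1 - I)] := by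
  rw [rho_zU]
  exact algebraicIndependent_exp_pair (isAlgebraic_one.sub isAlgebraic_I) (isAlgebraic_two.mul isAlgebraic_I)
    (linearIndependent_pair_of_det (by norm_num))

/-- `(e^{1-i}, e^{1+i})` is ℚ-free. -/
theorem linearIndependent_zU_X : LinearIndependent ℚ ![cexp (1 - I), conj (cexp (1 - I))] := by
  rw [conj_exp_one_sub_I]
  exact (algebraicIndependent_exp_pair (isAlgebraic_one.sub isAlgebraic_I) (isAlgebraic_one.add isAlgebraic_I)
    (linearIndependent_pair_of_det (by norm_num))).linearIndependent

/-- `(1, e^{2i}, e^{-2i})` is ℚ-free (Lindemann–Weierstrass, Baker's form). -/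
theorem linearIndependent_zU_Y :
    LinearIndependent ℚ ![(1 : ℂ), conj (cexp (1 - I)) / cexp (1 - I), cexp (1 - I) / conj (cexp (1 - I))] := by
  rw [rho_zU, rho_zU_inv]
  have h := linearIndependent_exp_triple (a := 0) (b := 2 * I) (c := -(2 * I)) isAlgebraic_zero
    (isAlgebraic_two.mul isAlgebraic_I) (isAlgebraic_two.mul isAlgebraic_I).neg
    (fun e => by have := congrArg Complex.im e; norm_num at this)
    (fun e => by have := congrArg Complex.im e; norm_num at this)
    (fun e => by have := congrArg Complex.im e; norm_num at this)
  simpa using h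

/-- **Member `z_u` (D decided — holds — by theorem; nothing open is used):** `ε = 0 ⟹ 3 ≤ trdeg ℚ(z_u, e^{z_u})`. -/
theorem member_zU
    (hsplit : Algebra.trdeg ℚ ↥(adjoin ℚ (Set.range zU)) + Algebra.trdeg ℚ ↥(adjoin ℚ (Set.range (cexp ∘ zU))) ≤
      Algebra.trdeg ℚ ↥(adjoin ℚ (Set.range zU ∪ Set.range (cexp ∘ zU)))) :
    ((3 : ℕ) : Cardinal) ≤ Algebra.trdeg ℚ ↥(adjoin ℚ (Set.range zU ∪ Set.range (cexp ∘ zU))) :=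
  disjointSchanuel_powerPlane_unimodular algebraicIndependent_zU_pair linearIndependent_zU_X linearIndependent_zU_Y
    hsplit

/-- **By-product (unconditional): one of `exp(e^{1-i})`, `exp(e^{1+i})`, `exp(e^{1+3i})` is transcendental**
(Diaz' variant at `x = e^{1-i}`, `ρ = e^{2i}`). -/
theorem exists_transcendental_exp_exp_zU :
    Transcendental ℚ (cexp (cexp (1 - I))) ∨ Transcendental ℚ (cexp (cexp (1 + I))) ∨
      Transcendental ℚ (cexp (cexp (1 + 3 * I))) := by
  obtain ⟨k, hk⟩ := exists_transcendental_exp_powerPlane_unimodular linearIndependent_zU_X linearIndependent_zU_Y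
  have hk' : Transcendental ℚ (cexp (zU k)) := hk
  rw [zU_eq] at hk'
  fin_cases k
  · exact Or.inl (by simpa using hk')
  · exact Or.inr (Or.inl (by simpa using hk'))
  · exact Or.inr (Or.inr (by simpa using hk'))

/-- `z_u` is ℚ-free. -/
theorem zU_linearIndependent : LinearIndependent ℚ zU := by
  rw [zU_eq]
  exact linearIndependent_exp_triple (isAlgebraic_one.sub isAlgebraic_I) (isAlgebraic_one.add isAlgebraic_I)
    (isAlgebraic_one.add (isAlgebraic_three.mul isAlgebraic_I))
    (fun e => by have := congrArg Complex.im e; norm_num at this)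
    (fun e => by have := congrArg Complex.im e; norm_num at this)
    (fun e => by have := congrArg Complex.im e; norm_num at this)

end Summit.Schanuel.Schanuel.Theorems.RootDecomp1ConjugateSieve
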